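import Summits.QuantumFields.YangMills.Theses.UnitScaleTilt
import Summits.QuantumFields.YangMills.Theorems.UnitScaleTiltMinimiserStabilityRegPrAvgActionDefect
import Literature.Analysis.Calculus.HardyExteriorDecay

/-!
# Route `UnitScaleTilt` — crux K2 `HistoryTail` (stmt-QuantumFields-18916): ONE AVERAGING STEP OF (69)–(70) FOR THE ROUTE'S OWN
# AVERAGING, LOCALLY AND WITH THE MARGINAL CONSTANT — `Σ_{p′∈R′}|Ū(∂p′) − 1|² ≤ (1+ε)·L^{4−d}·Σ_{q under R′}|U(∂q) − 1|² + #R′·(1+ε⁻¹)·(435t²)²`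
# (support file; first brick S3a of sub-lemma S3 of the split card)

Fleet lead `ym-ust-18916-p1` (gen 0); split card `CARD-18916-K2-split.md` (evidence #12 on the item), sub-lemma **S3** (numerator: the large
block-averaged plaquette yields the small factor `exp(−¼p(g)²)` of [Balaban1985UV3] (71)).  Print derives (71) from the chain (69)–(70)
p.273: the deviation of an averaged plaquette is, to first order, the block mean of the deviations of the `L × L` squares below it, and
squaring costs EXACTLY the factor `L^{4−d}` (`= L` in `d = 3`, the ratio `β_{k}/β_{k+1}` of the bare couplings — no loss per step, which is
why the estimate survives `j → ∞` averagings where the sup-norm iteration of `UnitScaleTiltHistoryTailBoundedHeight` (p438760) loses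
`(151L²)²/L` per step).  The tree has this chain for print's averaging (42)–(43) of [Balaban1985Averaging] on the `ℤ³` model
(`B10Eq69Local`/`B10Eq70Squaring`/`B10Eq71Concrete`, lane `PerPlaquette71`) and, since today, the FIRST-ORDER coarse plaquette of the
ROUTE's averaging — the (0.4) block average with `exp[mean log]` on `SU(N)` — as `AvgActionDefect.dist1_plaqHol_avgFun_le_mean_add`
(p437295, seat ym3-torus-p1 g8) with the GLOBAL action inequality `wilsonAction4_avgFun_le` (p437535).

THIS FILE proves the LOCAL, `(1+ε)`-SHARP one-step form that the per-plaquette argument iterates (K2 memo §1, memo caveat on uniformity):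
* `dist1_sq_avgFun_le` — ONE coarse plaquette: `|Ū(∂p′) − 1|² ≤ (1+ε)·L²(L^d)⁻¹·Σ_{r,t,s}|U(∂q_{r,s,t}) − 1|² + (1+ε⁻¹)(435t²)²`
  (`(M + R)² ≤ (1+ε)M² + (1+ε⁻¹)R²` = the tree's `Literature.Analysis.Calculus.add_sq_le_eps`, Jensen over the `L^d` offsets,
  Cauchy–Schwarz over the `L²` plaquettes of a square);
* `sum_squares_le_of_subset` — the translated squares under a SET `R′` of coarse plaquettes cover each fine plaquette at most `L²` times
  (`AvgActionDefect.sum_coarse_squares` applied to an indicator);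
* `sum_dist1_sq_avgFun_le` — the REGION form displayed in the title, for every finite `R′` and every finite `S ⊇` the squares under `R′`;
* `sum_action_avgFun_le_su2` — the `SU(2)`, `d = 3` reading with the action density `1 − Re tr = ½|·−1|²`:
  `Σ_{p′∈R′}(1 − Re tr Ū(∂p′)) ≤ (1+ε)·L·Σ_{q∈S}(1 − Re tr U(∂q)) + #R′·(1+ε⁻¹)·(435t²)²/2`.
Hypotheses as in p437295: `PlaqSmall a U` on the fine lattice (GLOBAL smallness — the localisation to «regular near p′ only», needed for
the composite minimisers of (41), is NOT done here), `t = ((d+2)L)²a/4 ≤ 1/10`, `t < δ_N`, standing range `j + 1 ≤ m + K`.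

WHAT THIS IS NOT: not the iteration over `j` steps (S3b: needs the regularity profile (68) of the intermediate averaged fields), not (71)
(S3c: the `θ`-arithmetic `β_{K−j}θ(K−j)² = p(g_{K−j})²`), nothing of (41)/(47), nothing uses (α).
-/

noncomputable section

open scoped BigOperators Matrix.Norms.L2Operator

namespace Summit.QuantumFields.YangMills.Theorems.HistoryTailStokesStep

open Literature.MathematicalPhysics.QuantumFieldTheory.Balaban1983to89
open T4Continuum BlockAveraging AveragingRT ExpMeanLog BlockAveragingPlaquetteBound
open B10Eq47AxialChi (shiftN)
open Literature.Analysis.Calculus (add_sq_le_eps)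
open Summit.QuantumFields.YangMills.Theorems.AvgActionDefect
  (dist1_plaqHol_avgFun_le_mean_add sum_coarse_squares one_sub_reTr_eq_half_dist1_sq_su2 deltaSU_fin_two)

variable {n : Type*} [Fintype n] [DecidableEq n] [Nonempty n] {P : Params} {j : ℕ}

/-- **ONE COARSE PLAQUETTE, SQUARED, `(1+ε)`-SHARP**: under the hypotheses of p437295, for every `ε > 0`,
`|Ū(∂p′) − 1|² ≤ (1+ε)·L²·(L^d)⁻¹·Σ_r Σ_{t<L} Σ_{s<L} |U(∂q_{r,s,t}) − 1|² + (1+ε⁻¹)·(435t²)²` — Jensen over the `L^d` block offsets and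
Cauchy–Schwarz over the `L²` plaquettes of each translated square. [cite: Balaban1985UV3, (69)-(70) p.273; Balaban1987RG1, (0.4) p.253] -/
theorem dist1_sq_avgFun_le (hj : j + 1 ≤ P.m + P.K) {a : ℝ} (ha : 0 ≤ a)
    {U : GaugeField P j (Matrix.specialUnitaryGroup n ℂ)} (hU : PlaqSmall a U)
    (ht : ((((P.d + 2) * P.L : ℕ) : ℝ) ^ 2 / 4) * a ≤ 1 / 10) (hδ : ((((P.d + 2) * P.L : ℕ) : ℝ) ^ 2 / 4) * a < deltaSU n)
    {ε : ℝ} (hε : 0 < ε) (p : Plaq P (j + 1)) :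
    dist1 (GaugeField.plaqHol (avgFun (expMeanLogSU (n := n)) U) p) ^ 2 ≤
      (1 + ε) * ((P.L : ℝ) ^ 2 * ((P.L : ℝ) ^ P.d)⁻¹) *
          ∑ r : Fin P.d → Fin P.L, ∑ t ∈ Finset.range P.L, ∑ s ∈ Finset.range P.L,
            dist1 (GaugeField.plaqHol U ⟨shiftN (shiftN (Site.blockSite p.src r) p.ν t) p.μ s, p.μ, p.ν, p.hμν⟩) ^ 2 +
        (1 + ε⁻¹) * (435 * (((((P.d + 2) * P.L : ℕ) : ℝ) ^ 2 / 4) * a) ^ 2) ^ 2 := by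
  set τ : ℝ := ((((P.d + 2) * P.L : ℕ) : ℝ) ^ 2 / 4) * a with hτ
  set R : ℝ := 435 * τ ^ 2 with hR
  have hL : (0 : ℝ) < P.L := Nat.cast_pos.mpr P.L_pos
  have hLd : (0 : ℝ) < (P.L : ℝ) ^ P.d := by positivity
  -- the square sums
  let D : (Fin P.d → Fin P.L) → ℝ := fun r =>
    ∑ t ∈ Finset.range P.L, ∑ s ∈ Finset.range P.L,
      dist1 (GaugeField.plaqHol U ⟨shiftN (shiftN (Site.blockSite p.src r) p.ν t) p.μ s, p.μ, p.ν, p.hμν⟩)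
  let D₂ : (Fin P.d → Fin P.L) → ℝ := fun r =>
    ∑ t ∈ Finset.range P.L, ∑ s ∈ Finset.range P.L,
      dist1 (GaugeField.plaqHol U ⟨shiftN (shiftN (Site.blockSite p.src r) p.ν t) p.μ s, p.μ, p.ν, p.hμν⟩) ^ 2
  have hM := dist1_plaqHol_avgFun_le_mean_add (n := n) hj ha hU ht hδ p
  set M : ℝ := ((P.L : ℝ) ^ P.d)⁻¹ * ∑ r : Fin P.d → Fin P.L, D r with hMdef
  have hM' : dist1 (GaugeField.plaqHol (avgFun (expMeanLogSU (n := n)) U) p) ≤ M + R := hM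
  have hD0 : ∀ r, 0 ≤ D r := fun r =>
    Finset.sum_nonneg fun _ _ => Finset.sum_nonneg fun _ _ => GaugeGroup.dist1_nonneg _
  have hM0 : 0 ≤ M := mul_nonneg (inv_nonneg.mpr hLd.le) (Finset.sum_nonneg fun r _ => hD0 r)
  have hR0 : 0 ≤ R := by positivity
  -- Jensen over the offsets: `M² ≤ (L^d)⁻¹ Σ_r D_r²`
  have hJ : M ^ 2 ≤ ((P.L : ℝ) ^ P.d)⁻¹ * ∑ r : Fin P.d → Fin P.L, D r ^ 2 := by
    have h := sq_sum_le_card_mul_sum_sq (s := (Finset.univ : Finset (Fin P.d → Fin P.L))) (f := fun r => D r)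
    rw [Finset.card_univ, Fintype.card_fun, Fintype.card_fin, Fintype.card_fin] at h
    push_cast at h
    rw [hMdef, mul_pow]
    calc (((P.L : ℝ) ^ P.d)⁻¹) ^ 2 * (∑ r, D r) ^ 2 ≤ (((P.L : ℝ) ^ P.d)⁻¹) ^ 2 * ((P.L : ℝ) ^ P.d * ∑ r, D r ^ 2) :=
          mul_le_mul_of_nonneg_left h (sq_nonneg _)
      _ = ((P.L : ℝ) ^ P.d)⁻¹ * ∑ r, D r ^ 2 := by field_simp
  -- Cauchy–Schwarz over the `L²` plaquettes of a square: `D_r² ≤ L² D₂_r`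
  have hCS : ∀ r, D r ^ 2 ≤ (P.L : ℝ) ^ 2 * D₂ r := by
    intro r
    have h1 := sq_sum_le_card_mul_sum_sq (s := Finset.range P.L) (f := fun t => ∑ s ∈ Finset.range P.L,
      dist1 (GaugeField.plaqHol U ⟨shiftN (shiftN (Site.blockSite p.src r) p.ν t) p.μ s, p.μ, p.ν, p.hμν⟩))
    have h2 : ∀ t ∈ Finset.range P.L, (∑ s ∈ Finset.range P.L,
        dist1 (GaugeField.plaqHol U ⟨shiftN (shiftN (Site.blockSite p.src r) p.ν t) p.μ s, p.μ, p.ν, p.hμν⟩)) ^ 2 ≤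
        P.L * ∑ s ∈ Finset.range P.L,
          dist1 (GaugeField.plaqHol U ⟨shiftN (shiftN (Site.blockSite p.src r) p.ν t) p.μ s, p.μ, p.ν, p.hμν⟩) ^ 2 := by
      intro t _
      have h := sq_sum_le_card_mul_sum_sq (s := Finset.range P.L) (f := fun s =>
        dist1 (GaugeField.plaqHol U ⟨shiftN (shiftN (Site.blockSite p.src r) p.ν t) p.μ s, p.μ, p.ν, p.hμν⟩))
      rwa [Finset.card_range] at h
    rw [Finset.card_range] at h1
    calc D r ^ 2 ≤ P.L * ∑ t ∈ Finset.range P.L, (∑ s ∈ Finset.range P.L,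
          dist1 (GaugeField.plaqHol U ⟨shiftN (shiftN (Site.blockSite p.src r) p.ν t) p.μ s, p.μ, p.ν, p.hμν⟩)) ^ 2 := h1
      _ ≤ P.L * ∑ t ∈ Finset.range P.L, (P.L * ∑ s ∈ Finset.range P.L,
          dist1 (GaugeField.plaqHol U ⟨shiftN (shiftN (Site.blockSite p.src r) p.ν t) p.μ s, p.μ, p.ν, p.hμν⟩) ^ 2) :=
          mul_le_mul_of_nonneg_left (Finset.sum_le_sum h2) hL.le
      _ = (P.L : ℝ) ^ 2 * D₂ r := by rw [← Finset.mul_sum]; ring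
  have hJ2 : M ^ 2 ≤ ((P.L : ℝ) ^ 2 * ((P.L : ℝ) ^ P.d)⁻¹) * ∑ r : Fin P.d → Fin P.L, D₂ r := by
    calc M ^ 2 ≤ ((P.L : ℝ) ^ P.d)⁻¹ * ∑ r : Fin P.d → Fin P.L, D r ^ 2 := hJ
      _ ≤ ((P.L : ℝ) ^ P.d)⁻¹ * ∑ r : Fin P.d → Fin P.L, (P.L : ℝ) ^ 2 * D₂ r :=
          mul_le_mul_of_nonneg_left (Finset.sum_le_sum fun r _ => hCS r) (inv_nonneg.mpr hLd.le)
      _ = ((P.L : ℝ) ^ 2 * ((P.L : ℝ) ^ P.d)⁻¹) * ∑ r : Fin P.d → Fin P.L, D₂ r := by rw [← Finset.mul_sum]; ring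
  -- assemble
  have h0 : 0 ≤ dist1 (GaugeField.plaqHol (avgFun (expMeanLogSU (n := n)) U) p) := GaugeGroup.dist1_nonneg _
  have hε1 : 0 ≤ 1 + ε := by linarith
  calc dist1 (GaugeField.plaqHol (avgFun (expMeanLogSU (n := n)) U) p) ^ 2 ≤ (M + R) ^ 2 :=
        pow_le_pow_left₀ h0 hM' 2
    _ ≤ (1 + ε) * M ^ 2 + (1 + ε⁻¹) * R ^ 2 := add_sq_le_eps M R hε
    _ ≤ (1 + ε) * (((P.L : ℝ) ^ 2 * ((P.L : ℝ) ^ P.d)⁻¹) * ∑ r : Fin P.d → Fin P.L, D₂ r) + (1 + ε⁻¹) * R ^ 2 := by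
        gcongr
    _ = _ := by ring

/-- **THE SQUARES UNDER A REGION COVER EACH FINE PLAQUETTE AT MOST `L²` TIMES** (standing range): for `g ≥ 0`, a finite set `R′` of coarse
plaquettes and any finite `S` of fine plaquettes containing every `q_{r,s,t}(p′)`, `p′ ∈ R′`:
`Σ_{p′∈R′} Σ_r Σ_{t,s} g(q_{r,s,t}(p′)) ≤ L²·Σ_{q∈S} g(q)` (`sum_coarse_squares` on `g·1_S`). [folklore] -/
theorem sum_squares_le_of_subset (hj : j + 1 ≤ P.m + P.K) {g : Plaq P j → ℝ} (hg : ∀ q, 0 ≤ g q)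
    (R' : Finset (Plaq P (j + 1))) (S : Finset (Plaq P j))
    (hS : ∀ p ∈ R', ∀ (r : Fin P.d → Fin P.L), ∀ t ∈ Finset.range P.L, ∀ s ∈ Finset.range P.L,
      (⟨shiftN (shiftN (Site.blockSite p.src r) p.ν t) p.μ s, p.μ, p.ν, p.hμν⟩ : Plaq P j) ∈ S) :
    ∑ p ∈ R', ∑ r : Fin P.d → Fin P.L, ∑ t ∈ Finset.range P.L, ∑ s ∈ Finset.range P.L,
        g ⟨shiftN (shiftN (Site.blockSite p.src r) p.ν t) p.μ s, p.μ, p.ν, p.hμν⟩ ≤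
      (P.L : ℝ) ^ 2 * ∑ q ∈ S, g q := by
  classical
  -- replace `g` by `g·1_S` on the left (no change), extend the outer sum to all coarse plaquettes, count
  set g' : Plaq P j → ℝ := fun q => if q ∈ S then g q else 0 with hg'
  have hg'0 : ∀ q, 0 ≤ g' q := fun q => by simp only [hg']; split_ifs <;> [exact hg q; exact le_rfl]
  have hleft : ∑ p ∈ R', ∑ r : Fin P.d → Fin P.L, ∑ t ∈ Finset.range P.L, ∑ s ∈ Finset.range P.L,
        g ⟨shiftN (shiftN (Site.blockSite p.src r) p.ν t) p.μ s, p.μ, p.ν, p.hμν⟩ =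
      ∑ p ∈ R', ∑ r : Fin P.d → Fin P.L, ∑ t ∈ Finset.range P.L, ∑ s ∈ Finset.range P.L,
        g' ⟨shiftN (shiftN (Site.blockSite p.src r) p.ν t) p.μ s, p.μ, p.ν, p.hμν⟩ := by
    refine Finset.sum_congr rfl fun p hp => Finset.sum_congr rfl fun r _ =>
      Finset.sum_congr rfl fun t ht => Finset.sum_congr rfl fun s hs => ?_
    simp only [hg', if_pos (hS p hp r t ht s hs)]
  have hright : (P.L : ℝ) ^ 2 * ∑ q ∈ S, g q = (P.L : ℝ) ^ 2 * ∑ q : Plaq P j, g' q := by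
    congr 1
    rw [← Finset.sum_filter_add_sum_filter_not Finset.univ (fun q => q ∈ S)]
    have h1 : ∑ q ∈ Finset.univ.filter (fun q : Plaq P j => q ∈ S), g' q = ∑ q ∈ S, g q := by
      have hfs : Finset.univ.filter (fun q : Plaq P j => q ∈ S) = S := by ext q; simp
      rw [hfs]
      exact Finset.sum_congr rfl fun q hq => by simp only [hg', if_pos hq]
    have h2 : ∑ q ∈ Finset.univ.filter (fun q : Plaq P j => ¬ q ∈ S), g' q = 0 :=
      Finset.sum_eq_zero fun q hq => by
        simp only [Finset.mem_filter, Finset.mem_univ, true_and] at hq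
        simp only [hg', if_neg hq]
    rw [h1, h2, add_zero]
  rw [hleft, hright, ← sum_coarse_squares hj g']
  refine Finset.sum_le_sum_of_subset_of_nonneg (Finset.subset_univ R') fun p _ _ => ?_
  exact Finset.sum_nonneg fun _ _ => Finset.sum_nonneg fun _ _ => Finset.sum_nonneg fun _ _ => hg'0 _

/-- **THE REGION FORM — ONE STEP OF (69)–(70) FOR THE ROUTE'S AVERAGING WITH THE MARGINAL CONSTANT `L^{4−d}`**: under the hypotheses of
p437295, for every `ε > 0`, every finite set `R′` of coarse plaquettes and every finite `S` containing the squares under `R′`,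
`Σ_{p′∈R′}|Ū(∂p′) − 1|² ≤ (1+ε)·L⁴(L^d)⁻¹·Σ_{q∈S}|U(∂q) − 1|² + #R′·(1+ε⁻¹)·(435t²)²`.
[cite: Balaban1985UV3, (69)-(70) p.273; Balaban1987RG1, (0.4) p.253] -/
theorem sum_dist1_sq_avgFun_le (hj : j + 1 ≤ P.m + P.K) {a : ℝ} (ha : 0 ≤ a)
    {U : GaugeField P j (Matrix.specialUnitaryGroup n ℂ)} (hU : PlaqSmall a U)
    (ht : ((((P.d + 2) * P.L : ℕ) : ℝ) ^ 2 / 4) * a ≤ 1 / 10) (hδ : ((((P.d + 2) * P.L : ℕ) : ℝ) ^ 2 / 4) * a < deltaSU n)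
    {ε : ℝ} (hε : 0 < ε) (R' : Finset (Plaq P (j + 1))) (S : Finset (Plaq P j))
    (hS : ∀ p ∈ R', ∀ (r : Fin P.d → Fin P.L), ∀ t ∈ Finset.range P.L, ∀ s ∈ Finset.range P.L,
      (⟨shiftN (shiftN (Site.blockSite p.src r) p.ν t) p.μ s, p.μ, p.ν, p.hμν⟩ : Plaq P j) ∈ S) :
    ∑ p ∈ R', dist1 (GaugeField.plaqHol (avgFun (expMeanLogSU (n := n)) U) p) ^ 2 ≤
      (1 + ε) * ((P.L : ℝ) ^ 4 * ((P.L : ℝ) ^ P.d)⁻¹) * ∑ q ∈ S, dist1 (GaugeField.plaqHol U q) ^ 2 +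
        R'.card * ((1 + ε⁻¹) * (435 * (((((P.d + 2) * P.L : ℕ) : ℝ) ^ 2 / 4) * a) ^ 2) ^ 2) := by
  have hε1 : 0 ≤ 1 + ε := by linarith
  have hL0 : (0 : ℝ) ≤ (P.L : ℝ) ^ 2 * ((P.L : ℝ) ^ P.d)⁻¹ := by positivity
  have hstep := fun p (_ : p ∈ R') => dist1_sq_avgFun_le (n := n) hj ha hU ht hδ hε p
  refine (Finset.sum_le_sum hstep).trans ?_
  rw [Finset.sum_add_distrib, Finset.sum_const, nsmul_eq_mul, ← Finset.mul_sum]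
  refine add_le_add ?_ le_rfl
  have hcount := sum_squares_le_of_subset hj (g := fun q => dist1 (GaugeField.plaqHol U q) ^ 2) (fun q => sq_nonneg _) R' S hS
  calc (1 + ε) * ((P.L : ℝ) ^ 2 * ((P.L : ℝ) ^ P.d)⁻¹) *
        ∑ p ∈ R', ∑ r : Fin P.d → Fin P.L, ∑ t ∈ Finset.range P.L, ∑ s ∈ Finset.range P.L,
          dist1 (GaugeField.plaqHol U ⟨shiftN (shiftN (Site.blockSite p.src r) p.ν t) p.μ s, p.μ, p.ν, p.hμν⟩) ^ 2
      ≤ (1 + ε) * ((P.L : ℝ) ^ 2 * ((P.L : ℝ) ^ P.d)⁻¹) * ((P.L : ℝ) ^ 2 * ∑ q ∈ S, dist1 (GaugeField.plaqHol U q) ^ 2) :=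
        mul_le_mul_of_nonneg_left hcount (mul_nonneg hε1 hL0)
    _ = (1 + ε) * ((P.L : ℝ) ^ 4 * ((P.L : ℝ) ^ P.d)⁻¹) * ∑ q ∈ S, dist1 (GaugeField.plaqHol U q) ^ 2 := by ring

/-- **THE `SU(2)`, `d = 3` READING WITH THE ACTION DENSITY** (`1 − Re tr W = ½|W − 1|²` on `SU(2)`, `δ₂ = 1/3`): for the route's families
(`P.d = 3`), `Σ_{p′∈R′}(1 − Re tr Ū(∂p′)) ≤ (1+ε)·L·Σ_{q∈S}(1 − Re tr U(∂q)) + #R′·(1+ε⁻¹)·(435t²)²/2` — the factor `L` is exactly the ratio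
`β_i/β_{i+1}` of the route's bare couplings, so `β_{i}·Σ_{R′}(1 − Re tr Ū) ≤ (1+ε)·β_{i+1}·Σ_S(1 − Re tr U) + …`: ONE STEP OF (70) WITHOUT LOSS.
[cite: Balaban1985UV3, (69)-(70) p.273; Balaban1987RG1, (0.14) p.254] -/
theorem sum_action_avgFun_le_su2 (hd : P.d = 3) (hj : j + 1 ≤ P.m + P.K) {a : ℝ} (ha : 0 ≤ a)
    {U : GaugeField P j (Matrix.specialUnitaryGroup (Fin 2) ℂ)} (hU : PlaqSmall a U)
    (ht : ((((P.d + 2) * P.L : ℕ) : ℝ) ^ 2 / 4) * a ≤ 1 / 10)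
    {ε : ℝ} (hε : 0 < ε) (R' : Finset (Plaq P (j + 1))) (S : Finset (Plaq P j))
    (hS : ∀ p ∈ R', ∀ (r : Fin P.d → Fin P.L), ∀ t ∈ Finset.range P.L, ∀ s ∈ Finset.range P.L,
      (⟨shiftN (shiftN (Site.blockSite p.src r) p.ν t) p.μ s, p.μ, p.ν, p.hμν⟩ : Plaq P j) ∈ S) :
    ∑ p ∈ R', (1 - reTr (GaugeField.plaqHol (avgFun (expMeanLogSU (n := Fin 2)) U) p)) ≤
      (1 + ε) * (P.L : ℝ) * ∑ q ∈ S, (1 - reTr (GaugeField.plaqHol U q)) +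
        R'.card * ((1 + ε⁻¹) * (435 * (((((P.d + 2) * P.L : ℕ) : ℝ) ^ 2 / 4) * a) ^ 2) ^ 2) / 2 := by
  have hδ : ((((P.d + 2) * P.L : ℕ) : ℝ) ^ 2 / 4) * a < deltaSU (Fin 2) := by rw [deltaSU_fin_two]; linarith
  have h := sum_dist1_sq_avgFun_le (n := Fin 2) hj ha hU ht hδ hε R' S hS
  have hL : (0 : ℝ) < P.L := Nat.cast_pos.mpr P.L_pos
  have hLpow : (P.L : ℝ) ^ 4 * ((P.L : ℝ) ^ P.d)⁻¹ = P.L := by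
    rw [hd]; field_simp
  rw [hLpow] at h
  simp only [one_sub_reTr_eq_half_dist1_sq_su2]
  rw [← Finset.mul_sum, ← Finset.mul_sum]
  nlinarith [h]

end Summit.QuantumFields.YangMills.Theorems.HistoryTailStokesStep

end
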